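import Summits.BirchSwinnertonDyer.BirchSwinnertonDyer.Theorems.PrintCFramBottomClassIndexLawFiveLeKrizLiLocusOfPrints
import Summits.BirchSwinnertonDyer.BirchSwinnertonDyer.Theorems.PrintCFramBottomClassIndexLawFiveLeKrizLiLocusCharacterData
import Summits.BirchSwinnertonDyer.BirchSwinnertonDyer.Theorems.PrintCFramBottomClassIndexLawFiveLeKrizLiBinders
import Summits.BirchSwinnertonDyer.BirchSwinnertonDyer.Theorems.PrintCFramBottomClassIndexLawFiveLeKrizLi4BlocksB19
import Summits.BirchSwinnertonDyer.BirchSwinnertonDyer.Theorems.PrintCFramBottomClassIndexLawFiveLeKrizLi4BlocksC19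
import Summits.BirchSwinnertonDyer.BirchSwinnertonDyer.Theorems.PrintCFramBottomClassIndexLawFiveLeKrizLi4HeegnerHypothesis19and43and67
import Literature.NumberTheory.QuadraticFields.FundamentalDiscriminant
import Literature.NumberTheory.QuadraticFields.ImaginaryQuadraticPrescribedSplitting
import HarnessLib

/-!
# Crux `PrintCFram.BottomClassIndexLawFiveLe` (stmt-BirchSwinnertonDyer-20372), line `eisenstein-resource-bdp-line`:
# THE CRUX RESTRICTED TO EACH WINDOW CLASS ON THE KRIZ–LI LOCUS (Classes19A; p = 19) — `BSD_p(W)` and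
# `RamifiedCMBottomClassIndexLawAtZp W p` BY NAME for every globally minimal member of analytic rank one, CONDITIONAL ON REFEREED PRINT ONLY
# (five citations + Kriz–Li 2019 Thm. 1.20): NO field, NO Heegner datum, NO `L`-value, NO character / Bernoulli hypothesis
# (cell `bsd-print-cfram`, width seat `bsd-line-cfram-p1-w7` g2; THEOREMS ONLY, `--supports` 20372; BSD is not proved by any of this)

HONEST FRAMING. Nothing here proves BSD or closes a stub; no definition, no named fact, no `sorry`. Every theorem is CONDITIONAL on the five
refereed named facts of the registry's `stub_prints` (Hsieh 2014 Thm. A, Liu–Zhang–Zhang 2018, `ToricPublishedInputs`, Burungale–Flach 2024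
Cor. 2, Mazur–Wiles 1984 Thm. 2) and on Kriz–Li 2019 Thm. 1.20 (`stub_krizLi`); its only other hypotheses are CLASS MEMBERSHIP (`W ∼ W₁` with
`C • W₁ = A(p)^{(d)}`, resp. `W ∼ A(p)`), global minimality and `W.analyticRank = 1` — i.e. exactly the crux's own binders on that class.
WHAT IS ASSEMBLED (all inputs are tree theorems of this cell): the census Heegner field `K'' = ℚ(√d_K)` is CONSTRUCTED as a type
(`Quadratic.exists_numberField_discr_eq`, `Quadratic.isTotallyComplex_of_discr_neg`); the class's Kriz–Li character block `(ψ, ω, ε_K)` with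
(1), (3), (4) is w5 g0 / w3 g2–g3's `exists_krizLiCharacterBlock_<label>` (kernel Bernoulli certificates `KrizLi4Cert*`); the Heegner hypothesis
for `N_W` is `satisfiesHeegnerHypothesis_<label>`; the Heegner data and the `L`-value `L(W^{(d_K)},1) ≠ 0` are PRINT on the locus — w6 g2's
`KrizLiLValueFree.exists_krizLiDatum_of_characterData` (p662614: `exists_isHeegnerPoint` of `ToricPublishedInputs` + Kriz–Li Thm. 1.20 ⟹ `log_ω P ≠ 0`
⟹ `P` non-torsion ⟹ Gross–Zagier); class membership gives `HasCM` / `CMRamified` (`KrizLiLocusOfPrints.hasCM_and_cmRamified_of_isIsogenous_twist`,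
`KrizLiBinders.hasCM_bases` / `cmRamified_bases`); and THE KRIZ–LI LOCUS IS PRINT (this seat, p662184:
`KrizLiLocusOfPrints.bsdp_cmRamified_of_krizLiDatum_of_prints` = Road C's Stub H + LEAD g5's regular-locus theorem) concludes; the class law
follows from `BSD_p` by k7r-c4's `ramifiedCMBottomClassIndexLawAtZp_of_bsdp` (Cassels, modularity, GZK inside the prints).
Per class: **`bsdp_<label>`** and **`ramifiedCMBottomClassIndexLawAtZp_<label>`**. Classes:
`9025a1` (`A(19)^{(5)}`, `d_K = -51`); `23104a1` (`A(19)^{(2)}`, `d_K = -15`); `51984cc1` (`A(19)^{(3)}`, `d_K = -143`);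
`61009a1` (`A(19)^{(13)}`, `d_K = -51`); `104329a1` (`A(19)^{(17)}`, `d_K = -15`); `159201t1` (`A(19)^{(21)}`, `d_K = -143`).
beyond-print theorem: NO — these are print-conditional closures of the crux on 38 of the 65 rank-one window classes of the `≥ 5` leaf; the
research residue of C2 on this line stays the off-locus pair (17424bl1@11, 305809c1@7; `p = 7` classes are Route U's, not covered here).
References: [KrizLi2019] Thm. 1.20 (pp. 7–8), Rem. 1.21; [MazurWiles1984] Thm. 2; [GrossZagier1986] I.(6.3), (7.3); [BurungaleFlach2024] Cor. 2;
[Hsieh2014] Thm. A; [LiuZhangZhang2018] Thms. 1.5.1, 1.5.3; [Cassels1965ArithmeticVIII]; [Cox2013] §1.C, Thm. 7.7; [GrossLMS1991] §1.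
-/

set_option autoImplicit false
-- the summit namespace `Summit.BirchSwinnertonDyer.BirchSwinnertonDyer` repeats the problem name by design (D-0017)
set_option linter.dupNamespace false

noncomputable section

open scoped Classical

namespace Summit.BirchSwinnertonDyer.BirchSwinnertonDyer.Theorems.PrintCFram.KrizLiLocusClasses

open WeierstrassCurve IsDedekindDomain NumberField
  Literature.NumberTheory.EllipticCurves Literature.NumberTheory.EllipticCurves.ModularForms
  Literature.NumberTheory.EllipticCurves.Rank1Residual Literature.NumberTheory.EllipticCurves.KrizLi2019
  Literature.NumberTheory.QuadraticFields
  Summit.BirchSwinnertonDyer.Rank1Residual Summit.BirchSwinnertonDyer.Rank1Residual.X12.O11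
  Summit.BirchSwinnertonDyer.BirchSwinnertonDyer.Theses.UniversalToricDescent
  Summit.BirchSwinnertonDyer.BirchSwinnertonDyer.Theorems.RamifiedSevenEllipticUnits
  Summit.BirchSwinnertonDyer.BirchSwinnertonDyer.Theorems.PrintCFram

/-- **`BSD_19(W)` for every globally minimal `W` of analytic rank one in the class `9025a1` (`W ∼ W₁ ≅ A(19)^{(5)}`), CONDITIONAL on
prints(5) + Kriz–Li Thm. 1.20 ONLY** (census Heegner field `d_K = -51` constructed; character block, Heegner hypothesis, Heegner data and
`L`-value discharged).
[cite: KrizLi2019, Thm. 1.20 (pp. 7–8), Rem. 1.21 (p. 8)] [cite: MazurWiles1984, Thm. 2 (p. 216)] [cite: GrossZagier1986, Thm. I.(6.3)] -/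
theorem bsdp_9025a1 [Fact (Nat.Prime 19)]
    (hprints : Hsieh2014.thmA_exists_isHsiehLFunction_unrPeriod_anyLevel ∧
      LiuZhangZhang2018.thm151_thm153_modularCurve_heegnerVector_additive ∧
      ToricPublishedInputs ∧ bsdTriple_of_hasCM_of_L_one_ne_zero ∧
      Literature.NumberTheory.NumberFields.MazurWiles1984.thm2_oddChiPart_classGroup_card_eq_pow_val_bernoulli)
    (hKL : KrizLi2019.thm120_padicLogHeegner_unit_of_bernoulli)
    (W W₁ : WeierstrassCurve ℚ) [W.IsElliptic] [W.IsGloballyMinimal] [W₁.IsElliptic]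
    (hiso : IsIsogenous W W₁) (hW₁ : ∃ C : VariableChange ℚ, C • W₁ = cm19.quadraticTwist ((5 : ℤ) : ℚ))
    (hr : W.analyticRank = 1) :
    BSDp W 19 := by
  -- the census Heegner field `K'' = ℚ(√-51)` as a TYPE (fundamental discriminant), imaginary quadratic
  obtain ⟨K, _, _, hK2, hdK⟩ := Quadratic.exists_numberField_discr_eq (D := (-51 : ℤ))
    (Or.inl ⟨by norm_num, by
      rw [← Int.squarefree_natAbs]
      exact (by rw [Nat.squarefree_iff_nodup_primeFactorsList (by norm_num)]; simp : Squarefree (51 : ℕ)), by norm_num⟩)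
  have hK : IsImaginaryQuadratic K := ⟨hK2, Quadratic.isTotallyComplex_of_discr_neg hK2 (by rw [hdK]; norm_num)⟩
  haveI : NeZero (NumberField.discr K).natAbs := ⟨by rw [hdK]; decide⟩
  obtain ⟨hCM, hram⟩ := KrizLiLocusOfPrints.hasCM_and_cmRamified_of_isIsogenous_twist cm19 KrizLiBinders.hasCM_bases.2.2.1
    KrizLiBinders.cmRamified_bases.2.2.1 (by norm_num) W W₁ hiso hW₁
  obtain ⟨f, _, ψ, ω, εK, hψ, hω, hss, ⟨h1, h1'⟩, h3, hεK, h4, -⟩ :=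
    KrizLiBindersTwisted.exists_krizLiCharacterBlock_9025a1 W W₁ hiso hW₁ K hK2 hdK
  exact KrizLiLocusOfPrints.bsdp_cmRamified_of_krizLiDatum_of_prints hprints hKL W hCM hram (by norm_num) hr
    (KrizLiLValueFree.exists_krizLiDatum_of_characterData hKL hprints.2.2.1 W hCM hram (by norm_num) hr K hK
      (KrizLiBindersTwisted.satisfiesHeegnerHypothesis_9025a1 W W₁ hiso hW₁ K hK2 hdK) (by rw [hdK]; decide)
      (by rw [hdK]; norm_num) f ψ ω hψ hω hss h1 h1' h3 εK hεK h4)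

/-- **The crux's conclusion `RamifiedCMBottomClassIndexLawAtZp W 19` for every globally minimal `W` of analytic rank one in the class
`9025a1`**, CONDITIONAL on prints(5) + Kriz–Li Thm. 1.20 only (from `bsdp_9025a1` by `ramifiedCMBottomClassIndexLawAtZp_of_bsdp`). BSD is not
proved by any of this.
[cite: KrizLi2019, Thm. 1.20 (pp. 7–8), Rem. 1.21 (p. 8)] [cite: MazurWiles1984, Thm. 2 (p. 216)] [cite: Cassels1965ArithmeticVIII] -/
theorem ramifiedCMBottomClassIndexLawAtZp_9025a1 [Fact (Nat.Prime 19)]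
    (hprints : Hsieh2014.thmA_exists_isHsiehLFunction_unrPeriod_anyLevel ∧
      LiuZhangZhang2018.thm151_thm153_modularCurve_heegnerVector_additive ∧
      ToricPublishedInputs ∧ bsdTriple_of_hasCM_of_L_one_ne_zero ∧
      Literature.NumberTheory.NumberFields.MazurWiles1984.thm2_oddChiPart_classGroup_card_eq_pow_val_bernoulli)
    (hKL : KrizLi2019.thm120_padicLogHeegner_unit_of_bernoulli)
    (W W₁ : WeierstrassCurve ℚ) [W.IsElliptic] [W.IsGloballyMinimal] [W₁.IsElliptic]
    (hiso : IsIsogenous W W₁) (hW₁ : ∃ C : VariableChange ℚ, C • W₁ = cm19.quadraticTwist ((5 : ℤ) : ℚ))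
    (hr : W.analyticRank = 1) :
    RamifiedCMBottomClassIndexLawAtZp W 19 := by
  have hprints7 := InputsPrints.prints7_of_prints4 ⟨hprints.1, hprints.2.1, hprints.2.2.1, hprints.2.2.2.1⟩
  obtain ⟨-, -, ⟨-, -, hGZK, -⟩, -, -, hmod, hCassels⟩ := hprints7
  exact RubinFormulaZpBsdp.ramifiedCMBottomClassIndexLawAtZp_of_bsdp hCassels hmod hGZK hr.le
    (bsdp_9025a1 hprints hKL W W₁ hiso hW₁ hr)

/-- **`BSD_19(W)` for every globally minimal `W` of analytic rank one in the class `23104a1` (`W ∼ W₁ ≅ A(19)^{(2)}`), CONDITIONAL on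
prints(5) + Kriz–Li Thm. 1.20 ONLY** (census Heegner field `d_K = -15` constructed; character block, Heegner hypothesis, Heegner data and
`L`-value discharged).
[cite: KrizLi2019, Thm. 1.20 (pp. 7–8), Rem. 1.21 (p. 8)] [cite: MazurWiles1984, Thm. 2 (p. 216)] [cite: GrossZagier1986, Thm. I.(6.3)] -/
theorem bsdp_23104a1 [Fact (Nat.Prime 19)]
    (hprints : Hsieh2014.thmA_exists_isHsiehLFunction_unrPeriod_anyLevel ∧
      LiuZhangZhang2018.thm151_thm153_modularCurve_heegnerVector_additive ∧
      ToricPublishedInputs ∧ bsdTriple_of_hasCM_of_L_one_ne_zero ∧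
      Literature.NumberTheory.NumberFields.MazurWiles1984.thm2_oddChiPart_classGroup_card_eq_pow_val_bernoulli)
    (hKL : KrizLi2019.thm120_padicLogHeegner_unit_of_bernoulli)
    (W W₁ : WeierstrassCurve ℚ) [W.IsElliptic] [W.IsGloballyMinimal] [W₁.IsElliptic]
    (hiso : IsIsogenous W W₁) (hW₁ : ∃ C : VariableChange ℚ, C • W₁ = cm19.quadraticTwist ((2 : ℤ) : ℚ))
    (hr : W.analyticRank = 1) :
    BSDp W 19 := by
  -- the census Heegner field `K'' = ℚ(√-15)` as a TYPE (fundamental discriminant), imaginary quadratic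
  obtain ⟨K, _, _, hK2, hdK⟩ := Quadratic.exists_numberField_discr_eq (D := (-15 : ℤ))
    (Or.inl ⟨by norm_num, by
      rw [← Int.squarefree_natAbs]
      exact (by rw [Nat.squarefree_iff_nodup_primeFactorsList (by norm_num)]; simp : Squarefree (15 : ℕ)), by norm_num⟩)
  have hK : IsImaginaryQuadratic K := ⟨hK2, Quadratic.isTotallyComplex_of_discr_neg hK2 (by rw [hdK]; norm_num)⟩
  haveI : NeZero (NumberField.discr K).natAbs := ⟨by rw [hdK]; decide⟩
  obtain ⟨hCM, hram⟩ := KrizLiLocusOfPrints.hasCM_and_cmRamified_of_isIsogenous_twist cm19 KrizLiBinders.hasCM_bases.2.2.1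
    KrizLiBinders.cmRamified_bases.2.2.1 (by norm_num) W W₁ hiso hW₁
  obtain ⟨f, _, ψ, ω, εK, hψ, hω, hss, ⟨h1, h1'⟩, h3, hεK, h4, -⟩ :=
    KrizLiBindersTwisted.exists_krizLiCharacterBlock_23104a1 W W₁ hiso hW₁ K hK2 hdK
  exact KrizLiLocusOfPrints.bsdp_cmRamified_of_krizLiDatum_of_prints hprints hKL W hCM hram (by norm_num) hr
    (KrizLiLValueFree.exists_krizLiDatum_of_characterData hKL hprints.2.2.1 W hCM hram (by norm_num) hr K hK
      (KrizLiBindersTwisted.satisfiesHeegnerHypothesis_23104a1 W W₁ hiso hW₁ K hK2 hdK) (by rw [hdK]; decide)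
      (by rw [hdK]; norm_num) f ψ ω hψ hω hss h1 h1' h3 εK hεK h4)

/-- **The crux's conclusion `RamifiedCMBottomClassIndexLawAtZp W 19` for every globally minimal `W` of analytic rank one in the class
`23104a1`**, CONDITIONAL on prints(5) + Kriz–Li Thm. 1.20 only (from `bsdp_23104a1` by `ramifiedCMBottomClassIndexLawAtZp_of_bsdp`). BSD is not
proved by any of this.
[cite: KrizLi2019, Thm. 1.20 (pp. 7–8), Rem. 1.21 (p. 8)] [cite: MazurWiles1984, Thm. 2 (p. 216)] [cite: Cassels1965ArithmeticVIII] -/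
theorem ramifiedCMBottomClassIndexLawAtZp_23104a1 [Fact (Nat.Prime 19)]
    (hprints : Hsieh2014.thmA_exists_isHsiehLFunction_unrPeriod_anyLevel ∧
      LiuZhangZhang2018.thm151_thm153_modularCurve_heegnerVector_additive ∧
      ToricPublishedInputs ∧ bsdTriple_of_hasCM_of_L_one_ne_zero ∧
      Literature.NumberTheory.NumberFields.MazurWiles1984.thm2_oddChiPart_classGroup_card_eq_pow_val_bernoulli)
    (hKL : KrizLi2019.thm120_padicLogHeegner_unit_of_bernoulli)
    (W W₁ : WeierstrassCurve ℚ) [W.IsElliptic] [W.IsGloballyMinimal] [W₁.IsElliptic]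
    (hiso : IsIsogenous W W₁) (hW₁ : ∃ C : VariableChange ℚ, C • W₁ = cm19.quadraticTwist ((2 : ℤ) : ℚ))
    (hr : W.analyticRank = 1) :
    RamifiedCMBottomClassIndexLawAtZp W 19 := by
  have hprints7 := InputsPrints.prints7_of_prints4 ⟨hprints.1, hprints.2.1, hprints.2.2.1, hprints.2.2.2.1⟩
  obtain ⟨-, -, ⟨-, -, hGZK, -⟩, -, -, hmod, hCassels⟩ := hprints7
  exact RubinFormulaZpBsdp.ramifiedCMBottomClassIndexLawAtZp_of_bsdp hCassels hmod hGZK hr.le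
    (bsdp_23104a1 hprints hKL W W₁ hiso hW₁ hr)

/-- **`BSD_19(W)` for every globally minimal `W` of analytic rank one in the class `51984cc1` (`W ∼ W₁ ≅ A(19)^{(3)}`), CONDITIONAL on
prints(5) + Kriz–Li Thm. 1.20 ONLY** (census Heegner field `d_K = -143` constructed; character block, Heegner hypothesis, Heegner data and
`L`-value discharged).
[cite: KrizLi2019, Thm. 1.20 (pp. 7–8), Rem. 1.21 (p. 8)] [cite: MazurWiles1984, Thm. 2 (p. 216)] [cite: GrossZagier1986, Thm. I.(6.3)] -/
theorem bsdp_51984cc1 [Fact (Nat.Prime 19)]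
    (hprints : Hsieh2014.thmA_exists_isHsiehLFunction_unrPeriod_anyLevel ∧
      LiuZhangZhang2018.thm151_thm153_modularCurve_heegnerVector_additive ∧
      ToricPublishedInputs ∧ bsdTriple_of_hasCM_of_L_one_ne_zero ∧
      Literature.NumberTheory.NumberFields.MazurWiles1984.thm2_oddChiPart_classGroup_card_eq_pow_val_bernoulli)
    (hKL : KrizLi2019.thm120_padicLogHeegner_unit_of_bernoulli)
    (W W₁ : WeierstrassCurve ℚ) [W.IsElliptic] [W.IsGloballyMinimal] [W₁.IsElliptic]
    (hiso : IsIsogenous W W₁) (hW₁ : ∃ C : VariableChange ℚ, C • W₁ = cm19.quadraticTwist ((3 : ℤ) : ℚ))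
    (hr : W.analyticRank = 1) :
    BSDp W 19 := by
  -- the census Heegner field `K'' = ℚ(√-143)` as a TYPE (fundamental discriminant), imaginary quadratic
  obtain ⟨K, _, _, hK2, hdK⟩ := Quadratic.exists_numberField_discr_eq (D := (-143 : ℤ))
    (Or.inl ⟨by norm_num, by
      rw [← Int.squarefree_natAbs]
      exact (by rw [Nat.squarefree_iff_nodup_primeFactorsList (by norm_num)]; simp : Squarefree (143 : ℕ)), by norm_num⟩)
  have hK : IsImaginaryQuadratic K := ⟨hK2, Quadratic.isTotallyComplex_of_discr_neg hK2 (by rw [hdK]; norm_num)⟩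
  haveI : NeZero (NumberField.discr K).natAbs := ⟨by rw [hdK]; decide⟩
  obtain ⟨hCM, hram⟩ := KrizLiLocusOfPrints.hasCM_and_cmRamified_of_isIsogenous_twist cm19 KrizLiBinders.hasCM_bases.2.2.1
    KrizLiBinders.cmRamified_bases.2.2.1 (by norm_num) W W₁ hiso hW₁
  obtain ⟨f, _, ψ, ω, εK, hψ, hω, hss, ⟨h1, h1'⟩, h3, hεK, h4, -⟩ :=
    KrizLiBindersTwisted.exists_krizLiCharacterBlock_51984cc1 W W₁ hiso hW₁ K hK2 hdK
  exact KrizLiLocusOfPrints.bsdp_cmRamified_of_krizLiDatum_of_prints hprints hKL W hCM hram (by norm_num) hr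
    (KrizLiLValueFree.exists_krizLiDatum_of_characterData hKL hprints.2.2.1 W hCM hram (by norm_num) hr K hK
      (KrizLiBindersTwisted.satisfiesHeegnerHypothesis_51984cc1 W W₁ hiso hW₁ K hK2 hdK) (by rw [hdK]; decide)
      (by rw [hdK]; norm_num) f ψ ω hψ hω hss h1 h1' h3 εK hεK h4)

/-- **The crux's conclusion `RamifiedCMBottomClassIndexLawAtZp W 19` for every globally minimal `W` of analytic rank one in the class
`51984cc1`**, CONDITIONAL on prints(5) + Kriz–Li Thm. 1.20 only (from `bsdp_51984cc1` by `ramifiedCMBottomClassIndexLawAtZp_of_bsdp`). BSD is not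
proved by any of this.
[cite: KrizLi2019, Thm. 1.20 (pp. 7–8), Rem. 1.21 (p. 8)] [cite: MazurWiles1984, Thm. 2 (p. 216)] [cite: Cassels1965ArithmeticVIII] -/
theorem ramifiedCMBottomClassIndexLawAtZp_51984cc1 [Fact (Nat.Prime 19)]
    (hprints : Hsieh2014.thmA_exists_isHsiehLFunction_unrPeriod_anyLevel ∧
      LiuZhangZhang2018.thm151_thm153_modularCurve_heegnerVector_additive ∧
      ToricPublishedInputs ∧ bsdTriple_of_hasCM_of_L_one_ne_zero ∧
      Literature.NumberTheory.NumberFields.MazurWiles1984.thm2_oddChiPart_classGroup_card_eq_pow_val_bernoulli)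
    (hKL : KrizLi2019.thm120_padicLogHeegner_unit_of_bernoulli)
    (W W₁ : WeierstrassCurve ℚ) [W.IsElliptic] [W.IsGloballyMinimal] [W₁.IsElliptic]
    (hiso : IsIsogenous W W₁) (hW₁ : ∃ C : VariableChange ℚ, C • W₁ = cm19.quadraticTwist ((3 : ℤ) : ℚ))
    (hr : W.analyticRank = 1) :
    RamifiedCMBottomClassIndexLawAtZp W 19 := by
  have hprints7 := InputsPrints.prints7_of_prints4 ⟨hprints.1, hprints.2.1, hprints.2.2.1, hprints.2.2.2.1⟩
  obtain ⟨-, -, ⟨-, -, hGZK, -⟩, -, -, hmod, hCassels⟩ := hprints7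
  exact RubinFormulaZpBsdp.ramifiedCMBottomClassIndexLawAtZp_of_bsdp hCassels hmod hGZK hr.le
    (bsdp_51984cc1 hprints hKL W W₁ hiso hW₁ hr)

/-- **`BSD_19(W)` for every globally minimal `W` of analytic rank one in the class `61009a1` (`W ∼ W₁ ≅ A(19)^{(13)}`), CONDITIONAL on
prints(5) + Kriz–Li Thm. 1.20 ONLY** (census Heegner field `d_K = -51` constructed; character block, Heegner hypothesis, Heegner data and
`L`-value discharged).
[cite: KrizLi2019, Thm. 1.20 (pp. 7–8), Rem. 1.21 (p. 8)] [cite: MazurWiles1984, Thm. 2 (p. 216)] [cite: GrossZagier1986, Thm. I.(6.3)] -/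
theorem bsdp_61009a1 [Fact (Nat.Prime 19)]
    (hprints : Hsieh2014.thmA_exists_isHsiehLFunction_unrPeriod_anyLevel ∧
      LiuZhangZhang2018.thm151_thm153_modularCurve_heegnerVector_additive ∧
      ToricPublishedInputs ∧ bsdTriple_of_hasCM_of_L_one_ne_zero ∧
      Literature.NumberTheory.NumberFields.MazurWiles1984.thm2_oddChiPart_classGroup_card_eq_pow_val_bernoulli)
    (hKL : KrizLi2019.thm120_padicLogHeegner_unit_of_bernoulli)
    (W W₁ : WeierstrassCurve ℚ) [W.IsElliptic] [W.IsGloballyMinimal] [W₁.IsElliptic]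
    (hiso : IsIsogenous W W₁) (hW₁ : ∃ C : VariableChange ℚ, C • W₁ = cm19.quadraticTwist ((13 : ℤ) : ℚ))
    (hr : W.analyticRank = 1) :
    BSDp W 19 := by
  -- the census Heegner field `K'' = ℚ(√-51)` as a TYPE (fundamental discriminant), imaginary quadratic
  obtain ⟨K, _, _, hK2, hdK⟩ := Quadratic.exists_numberField_discr_eq (D := (-51 : ℤ))
    (Or.inl ⟨by norm_num, by
      rw [← Int.squarefree_natAbs]
      exact (by rw [Nat.squarefree_iff_nodup_primeFactorsList (by norm_num)]; simp : Squarefree (51 : ℕ)), by norm_num⟩)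
  have hK : IsImaginaryQuadratic K := ⟨hK2, Quadratic.isTotallyComplex_of_discr_neg hK2 (by rw [hdK]; norm_num)⟩
  haveI : NeZero (NumberField.discr K).natAbs := ⟨by rw [hdK]; decide⟩
  obtain ⟨hCM, hram⟩ := KrizLiLocusOfPrints.hasCM_and_cmRamified_of_isIsogenous_twist cm19 KrizLiBinders.hasCM_bases.2.2.1
    KrizLiBinders.cmRamified_bases.2.2.1 (by norm_num) W W₁ hiso hW₁
  obtain ⟨f, _, ψ, ω, εK, hψ, hω, hss, ⟨h1, h1'⟩, h3, hεK, h4, -⟩ :=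
    KrizLiBindersTwisted.exists_krizLiCharacterBlock_61009a1 W W₁ hiso hW₁ K hK2 hdK
  exact KrizLiLocusOfPrints.bsdp_cmRamified_of_krizLiDatum_of_prints hprints hKL W hCM hram (by norm_num) hr
    (KrizLiLValueFree.exists_krizLiDatum_of_characterData hKL hprints.2.2.1 W hCM hram (by norm_num) hr K hK
      (KrizLiBindersTwisted.satisfiesHeegnerHypothesis_61009a1 W W₁ hiso hW₁ K hK2 hdK) (by rw [hdK]; decide)
      (by rw [hdK]; norm_num) f ψ ω hψ hω hss h1 h1' h3 εK hεK h4)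

/-- **The crux's conclusion `RamifiedCMBottomClassIndexLawAtZp W 19` for every globally minimal `W` of analytic rank one in the class
`61009a1`**, CONDITIONAL on prints(5) + Kriz–Li Thm. 1.20 only (from `bsdp_61009a1` by `ramifiedCMBottomClassIndexLawAtZp_of_bsdp`). BSD is not
proved by any of this.
[cite: KrizLi2019, Thm. 1.20 (pp. 7–8), Rem. 1.21 (p. 8)] [cite: MazurWiles1984, Thm. 2 (p. 216)] [cite: Cassels1965ArithmeticVIII] -/
theorem ramifiedCMBottomClassIndexLawAtZp_61009a1 [Fact (Nat.Prime 19)]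
    (hprints : Hsieh2014.thmA_exists_isHsiehLFunction_unrPeriod_anyLevel ∧
      LiuZhangZhang2018.thm151_thm153_modularCurve_heegnerVector_additive ∧
      ToricPublishedInputs ∧ bsdTriple_of_hasCM_of_L_one_ne_zero ∧
      Literature.NumberTheory.NumberFields.MazurWiles1984.thm2_oddChiPart_classGroup_card_eq_pow_val_bernoulli)
    (hKL : KrizLi2019.thm120_padicLogHeegner_unit_of_bernoulli)
    (W W₁ : WeierstrassCurve ℚ) [W.IsElliptic] [W.IsGloballyMinimal] [W₁.IsElliptic]
    (hiso : IsIsogenous W W₁) (hW₁ : ∃ C : VariableChange ℚ, C • W₁ = cm19.quadraticTwist ((13 : ℤ) : ℚ))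
    (hr : W.analyticRank = 1) :
    RamifiedCMBottomClassIndexLawAtZp W 19 := by
  have hprints7 := InputsPrints.prints7_of_prints4 ⟨hprints.1, hprints.2.1, hprints.2.2.1, hprints.2.2.2.1⟩
  obtain ⟨-, -, ⟨-, -, hGZK, -⟩, -, -, hmod, hCassels⟩ := hprints7
  exact RubinFormulaZpBsdp.ramifiedCMBottomClassIndexLawAtZp_of_bsdp hCassels hmod hGZK hr.le
    (bsdp_61009a1 hprints hKL W W₁ hiso hW₁ hr)

/-- **`BSD_19(W)` for every globally minimal `W` of analytic rank one in the class `104329a1` (`W ∼ W₁ ≅ A(19)^{(17)}`), CONDITIONAL on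
prints(5) + Kriz–Li Thm. 1.20 ONLY** (census Heegner field `d_K = -15` constructed; character block, Heegner hypothesis, Heegner data and
`L`-value discharged).
[cite: KrizLi2019, Thm. 1.20 (pp. 7–8), Rem. 1.21 (p. 8)] [cite: MazurWiles1984, Thm. 2 (p. 216)] [cite: GrossZagier1986, Thm. I.(6.3)] -/
theorem bsdp_104329a1 [Fact (Nat.Prime 19)]
    (hprints : Hsieh2014.thmA_exists_isHsiehLFunction_unrPeriod_anyLevel ∧
      LiuZhangZhang2018.thm151_thm153_modularCurve_heegnerVector_additive ∧
      ToricPublishedInputs ∧ bsdTriple_of_hasCM_of_L_one_ne_zero ∧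
      Literature.NumberTheory.NumberFields.MazurWiles1984.thm2_oddChiPart_classGroup_card_eq_pow_val_bernoulli)
    (hKL : KrizLi2019.thm120_padicLogHeegner_unit_of_bernoulli)
    (W W₁ : WeierstrassCurve ℚ) [W.IsElliptic] [W.IsGloballyMinimal] [W₁.IsElliptic]
    (hiso : IsIsogenous W W₁) (hW₁ : ∃ C : VariableChange ℚ, C • W₁ = cm19.quadraticTwist ((17 : ℤ) : ℚ))
    (hr : W.analyticRank = 1) :
    BSDp W 19 := by
  -- the census Heegner field `K'' = ℚ(√-15)` as a TYPE (fundamental discriminant), imaginary quadratic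
  obtain ⟨K, _, _, hK2, hdK⟩ := Quadratic.exists_numberField_discr_eq (D := (-15 : ℤ))
    (Or.inl ⟨by norm_num, by
      rw [← Int.squarefree_natAbs]
      exact (by rw [Nat.squarefree_iff_nodup_primeFactorsList (by norm_num)]; simp : Squarefree (15 : ℕ)), by norm_num⟩)
  have hK : IsImaginaryQuadratic K := ⟨hK2, Quadratic.isTotallyComplex_of_discr_neg hK2 (by rw [hdK]; norm_num)⟩
  haveI : NeZero (NumberField.discr K).natAbs := ⟨by rw [hdK]; decide⟩
  obtain ⟨hCM, hram⟩ := KrizLiLocusOfPrints.hasCM_and_cmRamified_of_isIsogenous_twist cm19 KrizLiBinders.hasCM_bases.2.2.1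
    KrizLiBinders.cmRamified_bases.2.2.1 (by norm_num) W W₁ hiso hW₁
  obtain ⟨f, _, ψ, ω, εK, hψ, hω, hss, ⟨h1, h1'⟩, h3, hεK, h4, -⟩ :=
    KrizLiBindersTwisted.exists_krizLiCharacterBlock_104329a1 W W₁ hiso hW₁ K hK2 hdK
  exact KrizLiLocusOfPrints.bsdp_cmRamified_of_krizLiDatum_of_prints hprints hKL W hCM hram (by norm_num) hr
    (KrizLiLValueFree.exists_krizLiDatum_of_characterData hKL hprints.2.2.1 W hCM hram (by norm_num) hr K hK
      (KrizLiBindersTwisted.satisfiesHeegnerHypothesis_104329a1 W W₁ hiso hW₁ K hK2 hdK) (by rw [hdK]; decide)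
      (by rw [hdK]; norm_num) f ψ ω hψ hω hss h1 h1' h3 εK hεK h4)

/-- **The crux's conclusion `RamifiedCMBottomClassIndexLawAtZp W 19` for every globally minimal `W` of analytic rank one in the class
`104329a1`**, CONDITIONAL on prints(5) + Kriz–Li Thm. 1.20 only (from `bsdp_104329a1` by `ramifiedCMBottomClassIndexLawAtZp_of_bsdp`). BSD is not
proved by any of this.
[cite: KrizLi2019, Thm. 1.20 (pp. 7–8), Rem. 1.21 (p. 8)] [cite: MazurWiles1984, Thm. 2 (p. 216)] [cite: Cassels1965ArithmeticVIII] -/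
theorem ramifiedCMBottomClassIndexLawAtZp_104329a1 [Fact (Nat.Prime 19)]
    (hprints : Hsieh2014.thmA_exists_isHsiehLFunction_unrPeriod_anyLevel ∧
      LiuZhangZhang2018.thm151_thm153_modularCurve_heegnerVector_additive ∧
      ToricPublishedInputs ∧ bsdTriple_of_hasCM_of_L_one_ne_zero ∧
      Literature.NumberTheory.NumberFields.MazurWiles1984.thm2_oddChiPart_classGroup_card_eq_pow_val_bernoulli)
    (hKL : KrizLi2019.thm120_padicLogHeegner_unit_of_bernoulli)
    (W W₁ : WeierstrassCurve ℚ) [W.IsElliptic] [W.IsGloballyMinimal] [W₁.IsElliptic]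
    (hiso : IsIsogenous W W₁) (hW₁ : ∃ C : VariableChange ℚ, C • W₁ = cm19.quadraticTwist ((17 : ℤ) : ℚ))
    (hr : W.analyticRank = 1) :
    RamifiedCMBottomClassIndexLawAtZp W 19 := by
  have hprints7 := InputsPrints.prints7_of_prints4 ⟨hprints.1, hprints.2.1, hprints.2.2.1, hprints.2.2.2.1⟩
  obtain ⟨-, -, ⟨-, -, hGZK, -⟩, -, -, hmod, hCassels⟩ := hprints7
  exact RubinFormulaZpBsdp.ramifiedCMBottomClassIndexLawAtZp_of_bsdp hCassels hmod hGZK hr.le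
    (bsdp_104329a1 hprints hKL W W₁ hiso hW₁ hr)

/-- **`BSD_19(W)` for every globally minimal `W` of analytic rank one in the class `159201t1` (`W ∼ W₁ ≅ A(19)^{(21)}`), CONDITIONAL on
prints(5) + Kriz–Li Thm. 1.20 ONLY** (census Heegner field `d_K = -143` constructed; character block, Heegner hypothesis, Heegner data and
`L`-value discharged).
[cite: KrizLi2019, Thm. 1.20 (pp. 7–8), Rem. 1.21 (p. 8)] [cite: MazurWiles1984, Thm. 2 (p. 216)] [cite: GrossZagier1986, Thm. I.(6.3)] -/
theorem bsdp_159201t1 [Fact (Nat.Prime 19)]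
    (hprints : Hsieh2014.thmA_exists_isHsiehLFunction_unrPeriod_anyLevel ∧
      LiuZhangZhang2018.thm151_thm153_modularCurve_heegnerVector_additive ∧
      ToricPublishedInputs ∧ bsdTriple_of_hasCM_of_L_one_ne_zero ∧
      Literature.NumberTheory.NumberFields.MazurWiles1984.thm2_oddChiPart_classGroup_card_eq_pow_val_bernoulli)
    (hKL : KrizLi2019.thm120_padicLogHeegner_unit_of_bernoulli)
    (W W₁ : WeierstrassCurve ℚ) [W.IsElliptic] [W.IsGloballyMinimal] [W₁.IsElliptic]
    (hiso : IsIsogenous W W₁) (hW₁ : ∃ C : VariableChange ℚ, C • W₁ = cm19.quadraticTwist ((21 : ℤ) : ℚ))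
    (hr : W.analyticRank = 1) :
    BSDp W 19 := by
  -- the census Heegner field `K'' = ℚ(√-143)` as a TYPE (fundamental discriminant), imaginary quadratic
  obtain ⟨K, _, _, hK2, hdK⟩ := Quadratic.exists_numberField_discr_eq (D := (-143 : ℤ))
    (Or.inl ⟨by norm_num, by
      rw [← Int.squarefree_natAbs]
      exact (by rw [Nat.squarefree_iff_nodup_primeFactorsList (by norm_num)]; simp : Squarefree (143 : ℕ)), by norm_num⟩)
  have hK : IsImaginaryQuadratic K := ⟨hK2, Quadratic.isTotallyComplex_of_discr_neg hK2 (by rw [hdK]; norm_num)⟩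
  haveI : NeZero (NumberField.discr K).natAbs := ⟨by rw [hdK]; decide⟩
  obtain ⟨hCM, hram⟩ := KrizLiLocusOfPrints.hasCM_and_cmRamified_of_isIsogenous_twist cm19 KrizLiBinders.hasCM_bases.2.2.1
    KrizLiBinders.cmRamified_bases.2.2.1 (by norm_num) W W₁ hiso hW₁
  obtain ⟨f, _, ψ, ω, εK, hψ, hω, hss, ⟨h1, h1'⟩, h3, hεK, h4, -⟩ :=
    KrizLiBindersTwisted.exists_krizLiCharacterBlock_159201t1 W W₁ hiso hW₁ K hK2 hdK
  exact KrizLiLocusOfPrints.bsdp_cmRamified_of_krizLiDatum_of_prints hprints hKL W hCM hram (by norm_num) hr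
    (KrizLiLValueFree.exists_krizLiDatum_of_characterData hKL hprints.2.2.1 W hCM hram (by norm_num) hr K hK
      (KrizLiBindersTwisted.satisfiesHeegnerHypothesis_159201t1 W W₁ hiso hW₁ K hK2 hdK) (by rw [hdK]; decide)
      (by rw [hdK]; norm_num) f ψ ω hψ hω hss h1 h1' h3 εK hεK h4)

/-- **The crux's conclusion `RamifiedCMBottomClassIndexLawAtZp W 19` for every globally minimal `W` of analytic rank one in the class
`159201t1`**, CONDITIONAL on prints(5) + Kriz–Li Thm. 1.20 only (from `bsdp_159201t1` by `ramifiedCMBottomClassIndexLawAtZp_of_bsdp`). BSD is not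
proved by any of this.
[cite: KrizLi2019, Thm. 1.20 (pp. 7–8), Rem. 1.21 (p. 8)] [cite: MazurWiles1984, Thm. 2 (p. 216)] [cite: Cassels1965ArithmeticVIII] -/
theorem ramifiedCMBottomClassIndexLawAtZp_159201t1 [Fact (Nat.Prime 19)]
    (hprints : Hsieh2014.thmA_exists_isHsiehLFunction_unrPeriod_anyLevel ∧
      LiuZhangZhang2018.thm151_thm153_modularCurve_heegnerVector_additive ∧
      ToricPublishedInputs ∧ bsdTriple_of_hasCM_of_L_one_ne_zero ∧
      Literature.NumberTheory.NumberFields.MazurWiles1984.thm2_oddChiPart_classGroup_card_eq_pow_val_bernoulli)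
    (hKL : KrizLi2019.thm120_padicLogHeegner_unit_of_bernoulli)
    (W W₁ : WeierstrassCurve ℚ) [W.IsElliptic] [W.IsGloballyMinimal] [W₁.IsElliptic]
    (hiso : IsIsogenous W W₁) (hW₁ : ∃ C : VariableChange ℚ, C • W₁ = cm19.quadraticTwist ((21 : ℤ) : ℚ))
    (hr : W.analyticRank = 1) :
    RamifiedCMBottomClassIndexLawAtZp W 19 := by
  have hprints7 := InputsPrints.prints7_of_prints4 ⟨hprints.1, hprints.2.1, hprints.2.2.1, hprints.2.2.2.1⟩
  obtain ⟨-, -, ⟨-, -, hGZK, -⟩, -, -, hmod, hCassels⟩ := hprints7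
  exact RubinFormulaZpBsdp.ramifiedCMBottomClassIndexLawAtZp_of_bsdp hCassels hmod hGZK hr.le
    (bsdp_159201t1 hprints hKL W W₁ hiso hW₁ hr)

end Summit.BirchSwinnertonDyer.BirchSwinnertonDyer.Theorems.PrintCFram.KrizLiLocusClasses

end
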